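import Literature.Analysis.FluidPDE.BesovBlowupRigidity
import Literature.Analysis.FluidPDE.NSCriticalClosureBesovKatoClass
import Literature.Analysis.FluidPDE.NSViscosityRescaling
import Literature.Analysis.FluidPDE.NSLerayHopfABCScaling
import Literature.Analysis.FluidPDE.BesovMildAssembly
import HarnessLib

/-!
# Discharge of `hasSmoothExtensionPast_of_eHomBesovNorm_bounded` (Gallagher–Koch–Planchon 2016,
# Thm. 1)

Analysis/FluidPDE proofs-only file (theorems only: no definition, no named fact; nothing accepted
is restated or changed). The named fact `hasSmoothExtensionPast_of_eHomBesovNorm_bounded`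
(`NSCriticalClosure.lean`; I. Gallagher, G. S. Koch, F. Planchon, *Blow-up of critical Besov
norms at a potential Navier–Stokes singularity*, Comm. Math. Phys. 343 (2016), Thm. 1, in
contrapositive form for classical Leray–Hopf solutions) is proved:
`hasSmoothExtensionPast_of_eHomBesovNorm_bounded_holds`. The landing pad
`hasSmoothExtensionPast_of_eHomBesovNorm_bounded_of_classical_regular` (`NSCriticalClosureBesovKatoClass.lean`)
reduces it to the regularity of every point of the final time; for unit viscosity this is
`regular_at_final_time_of_classical_besov_bounded` (`BesovBlowupRigidity.lean`, the blow-up and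
rigidity argument of Wang–Zhang 2017, §4, the Escauriaza–Seregin–Šverák route); a general
viscosity is reduced to `ν = 1` by the parabolic rescaling `ũ(s, x) = ν⁻¹ u(ν⁻¹ s, x)`
(`IsClassicalNSSolutionOn.viscosityRescale_set`, `IsLerayHopfOn.viscosityRescale`), under which the
Besov bound scales by `ν⁻¹` and essential boundedness on backward cylinders is transported back
(`regular_at_final_time_of_classical_besov_bounded_visc`).

## References

* I. Gallagher, G. S. Koch, F. Planchon, Comm. Math. Phys. 343 (2016) 39–82, Thm. 1. [GKP2016]
* W. Wang, Z. Zhang, Sci. China Math. 60 (2017) 637–650 = arXiv:1510.02589, §4. [WangZhang2016]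
-/

noncomputable section

open MeasureTheory Set Function Filter Topology TopologicalSpace Metric
open scoped NNReal ENNReal SchwartzMap

namespace Literature.Analysis.FluidPDE

/-! ### General viscosity -/

section Viscosity

variable {u : ℝ → EuclideanSpace ℝ (Fin 3) → EuclideanSpace ℝ (Fin 3)}
  {p : ℝ → EuclideanSpace ℝ (Fin 3) → ℝ}
  {U : ℝ → 𝓢'(EuclideanSpace ℝ (Fin 3), EuclideanSpace ℂ (Fin 3))}

set_option maxHeartbeats 1600000 in
/-- **Regularity at the final time, general viscosity** (reduction to `ν = 1` by
`ũ(s, x) = ν⁻¹ u(ν⁻¹ s, x)`, `p̃(s, x) = ν⁻² p(ν⁻¹ s, x)` on `[0, νT)`). [cite: GKP2016, Thm. 1] -/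
theorem regular_at_final_time_of_classical_besov_bounded_visc {ν : ℝ} (hν : 0 < ν)
    {r q : ℝ≥0∞} [Fact (1 ≤ r)] (hr3 : 3 < r) (hr : r < ⊤) (hq3 : 3 < q) (hq : q < ⊤)
    {T : ℝ} (hT : 0 < T)
    (hsol : IsClassicalNSSolutionOn (Ico 0 T) ν 0 u p) (hLH : IsLerayHopfOn T ν 0 (u 0) u)
    (hU : ∀ t ∈ Ico 0 T, IsDistributionOf (u t) (U t))
    (hsup : (⨆ t ∈ Ico 0 T, FunctionSpaces.eHomBesovNorm (-1 + 3 / r.toReal) r q (U t)) < ⊤)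
    (x₀ : EuclideanSpace ℝ (Fin 3)) :
    ∃ ρ : ℝ, 0 < ρ ∧ eLpNorm (uncurry u) ∞ (volume.restrict (parabolicCylinder ρ ((T : ℝ), x₀))) < ∞ := by
  have hν0 : ν ≠ 0 := hν.ne'
  have hνi : 0 < ν⁻¹ := inv_pos.2 hν
  -- ### the rescaled solution with unit viscosity on `[0, νT)`
  set u' : ℝ → EuclideanSpace ℝ (Fin 3) → EuclideanSpace ℝ (Fin 3) := timeRescale ν⁻¹ ν⁻¹ u with hu'
  set p' : ℝ → EuclideanSpace ℝ (Fin 3) → ℝ := timeRescale ν⁻¹ (ν⁻¹ ^ 2) p with hp'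
  have hT' : 0 < ν * T := mul_pos hν hT
  have hmaps : MapsTo (fun s => ν⁻¹ * s) (Ico 0 (ν * T)) (Ico 0 T) := by
    intro s hs
    refine ⟨mul_nonneg hνi.le hs.1, ?_⟩
    calc ν⁻¹ * s < ν⁻¹ * (ν * T) := mul_lt_mul_of_pos_left hs.2 hνi
      _ = T := by rw [← mul_assoc, inv_mul_cancel₀ hν0, one_mul]
  have hsol' : IsClassicalNSSolutionOn (Ico 0 (ν * T)) 1 0 u' p' := by
    have h := hsol.viscosityRescale_set hν0 hmaps (uniqueDiffOn_Ico 0 (ν * T))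
    rwa [timeRescale_zero_force] at h
  have hLH' : IsLerayHopfOn (ν * T) 1 0 (u' 0) u' := by
    have h := hLH.viscosityRescale hνi
    rw [timeRescale_zero_force, inv_mul_cancel₀ hν0, div_inv_eq_mul, mul_comm T ν] at h
    have e : (ν⁻¹ • u 0) = u' 0 := by
      rw [hu', timeRescale_zero]; rfl
    rw [e] at h
    exact h
  -- the rescaled distributions and their Besov bound
  set U' : ℝ → 𝓢'(EuclideanSpace ℝ (Fin 3), EuclideanSpace ℂ (Fin 3)) := fun s => ((ν⁻¹ : ℝ) : ℂ) • U (ν⁻¹ * s)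
    with hU'def
  have hU' : ∀ s ∈ Ico 0 (ν * T), IsDistributionOf (u' s) (U' s) := by
    intro s hs
    have h := (hU _ (hmaps hs)).const_smul ν⁻¹
    have e : u' s = ν⁻¹ • u (ν⁻¹ * s) := by rw [hu', timeRescale_slice]; rfl
    rw [e]
    exact h
  have ha : ((ν⁻¹ : ℝ) : ℂ) ≠ 0 := by exact_mod_cast hνi.ne'
  have hsup' : (⨆ s ∈ Ico 0 (ν * T), FunctionSpaces.eHomBesovNorm (-1 + 3 / r.toReal) r q (U' s)) < ⊤ := by
    refine lt_of_le_of_lt (b := ‖((ν⁻¹ : ℝ) : ℂ)‖ₑ * ⨆ t ∈ Ico 0 T,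
      FunctionSpaces.eHomBesovNorm (-1 + 3 / r.toReal) r q (U t)) (iSup₂_le fun s hs => ?_)
      (ENNReal.mul_lt_top enorm_lt_top hsup)
    rw [hU'def]
    dsimp only
    rw [eHomBesovNorm_smul _ _ _ ha]
    exact mul_le_mul' le_rfl (le_iSup₂ (f := fun t (_ : t ∈ Ico 0 T) =>
      FunctionSpaces.eHomBesovNorm (-1 + 3 / r.toReal) r q (U t)) (ν⁻¹ * s) (hmaps hs))
  -- ### regularity of the rescaled solution at `(νT, x₀)`
  obtain ⟨ρ, hρ, hbd⟩ := regular_at_final_time_of_classical_besov_bounded hr3 hr hq3 hq hT' hsol' hLH' hU' hsup' x₀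
  -- ### transport back
  set ρ' : ℝ := min ρ (ρ / Real.sqrt ν) with hρ'
  have hsν : 0 < Real.sqrt ν := Real.sqrt_pos.2 hν
  have hρ'pos : 0 < ρ' := lt_min hρ (div_pos hρ hsν)
  have hρ'ρ : ρ' ≤ ρ := min_le_left _ _
  have hρ'sq : ν * ρ' ^ 2 ≤ ρ ^ 2 := by
    have h1 : ρ' ≤ ρ / Real.sqrt ν := min_le_right _ _
    have h2 : ρ' ^ 2 ≤ (ρ / Real.sqrt ν) ^ 2 := pow_le_pow_left₀ hρ'pos.le h1 2
    rw [div_pow, Real.sq_sqrt hν.le] at h2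
    rw [le_div_iff₀ hν] at h2
    linarith
  refine ⟨ρ', hρ'pos, ?_⟩
  -- the essential bound of `u'` on `Q_ρ(νT, x₀)`
  rw [eLpNorm_exponent_top] at hbd ⊢
  set S : ℝ≥0∞ := eLpNormEssSup (uncurry u') (volume.restrict (parabolicCylinder ρ (ν * T, x₀))) with hS
  have hae : ∀ᵐ z ∂(volume.restrict (parabolicCylinder ρ (ν * T, x₀))), ‖uncurry u' z‖ₑ ≤ S :=
    ae_le_eLpNormEssSup
  rw [ae_restrict_iff' (isOpen_parabolicCylinder _ _).measurableSet] at hae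
  -- pull back along `(t, x) ↦ (ν t, x)`
  have hq1 : Measure.QuasiMeasurePreserving (fun t : ℝ => ν * t) volume volume := by
    refine ⟨measurable_const_mul ν, ?_⟩
    rw [Real.map_volume_mul_left hν0]
    exact Measure.smul_absolutelyContinuous
  have hqmp : Measure.QuasiMeasurePreserving
      (fun z : ℝ × EuclideanSpace ℝ (Fin 3) => (ν * z.1, z.2)) volume volume := by
    have h := MeasureTheory.QuasiMeasurePreserving.prodMap hq1
      (Measure.QuasiMeasurePreserving.id (volume : Measure (EuclideanSpace ℝ (Fin 3))))
    rw [Measure.volume_eq_prod]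
    exact h
  have hae' := hqmp.ae hae
  refine lt_of_le_of_lt (eLpNormEssSup_le_of_ae_enorm_bound (C := ‖ν‖ₑ * S) ?_)
    (ENNReal.mul_lt_top enorm_lt_top hbd)
  rw [ae_restrict_iff' (isOpen_parabolicCylinder _ _).measurableSet]
  filter_upwards [hae'] with z hz hzQ
  -- `(ν z.1, z.2) ∈ Q_ρ(νT, x₀)`
  have hmem : ((ν * z.1, z.2) : ℝ × EuclideanSpace ℝ (Fin 3)) ∈ parabolicCylinder ρ (ν * T, x₀) := by
    rw [mem_parabolicCylinder] at hzQ ⊢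
    refine ⟨⟨?_, ?_⟩, ball_subset_ball hρ'ρ hzQ.2⟩
    · dsimp only
      have h1 : T - ρ' ^ 2 < z.1 := hzQ.1.1
      nlinarith
    · dsimp only
      have h2 : z.1 < T := hzQ.1.2
      nlinarith
  have h := hz hmem
  -- `u' (ν t) x = ν⁻¹ • u t x`
  have e : uncurry u' (ν * z.1, z.2) = ν⁻¹ • u z.1 z.2 := by
    simp only [uncurry_apply_pair, hu', timeRescale_apply, ← mul_assoc, inv_mul_cancel₀ hν0, one_mul]
  rw [e, enorm_smul] at h
  have hνe : ‖ν⁻¹‖ₑ ≠ 0 := by simp [hν0]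
  have hνe' : ‖ν⁻¹‖ₑ ≠ ⊤ := enorm_ne_top
  calc ‖uncurry u z‖ₑ = ‖ν‖ₑ * (‖ν⁻¹‖ₑ * ‖u z.1 z.2‖ₑ) := by
        rw [← mul_assoc, ← enorm_mul, mul_inv_cancel₀ hν0, enorm_one, one_mul]; rfl
    _ ≤ ‖ν‖ₑ * S := mul_le_mul' le_rfl h

end Viscosity

/-! ### The discharge -/

/-- **Gallagher–Koch–Planchon 2016, Thm. 1 — discharge of the named fact
`hasSmoothExtensionPast_of_eHomBesovNorm_bounded`**: a classical Leray–Hopf solution from rapidly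
decaying data whose `Ḃ^{-1+3/p}_{p,q}` norm (`3 < p, q < ∞`) stays bounded up to `T` extends as a
classical solution past `T`. Proof: every point of the final time is regular
(`regular_at_final_time_of_classical_besov_bounded_visc`, the blow-up and rigidity argument of
Wang–Zhang 2017, §4, assembled in `BesovBlowupRigidity.lean`), and regular final times are passed
(`hasSmoothExtensionPast_of_eHomBesovNorm_bounded_of_classical_regular`). [cite: GKP2016, Thm. 1] [cite: WangZhang2016, §4] -/
theorem hasSmoothExtensionPast_of_eHomBesovNorm_bounded_holds :
    hasSmoothExtensionPast_of_eHomBesovNorm_bounded :=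
  hasSmoothExtensionPast_of_eHomBesovNorm_bounded_of_classical_regular
    fun _ν _T hν hT _u _π _U _r _q _ hr3 hr hq3 hq hsol hLH _ hU hsup x₀ =>
      regular_at_final_time_of_classical_besov_bounded_visc hν hr3 hr hq3 hq hT hsol hLH hU hsup x₀

end Literature.Analysis.FluidPDE

end
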